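import Summits.QuantumFields.YangMills.Theorems.SoloBlindLatticeGapAntipodal
import Summits.QuantumFields.YangMills.Theorems.SoloBlindInfraredFrontier
import HarnessLib

/-!
# Torus-uniform clustering on the time-zero algebra = antipodal decay, at fixed coupling
# (solo-QuantumFields-blind, rung D8, part 7)

Part 6 reduced the scheme-level conjunct `HasLatticeMassGap` on the time-zero spatial algebra to
antipodal diagonal decay.  This file states the underlying SINGLE-TORUS inequality and the
fixed-coupling (IR-1) form, in the vocabulary of `SoloBlindInfraredFrontier`:

* `abs_latticeConnectedCorr_le_of_endpoints` — on ONE odd torus `(ℤ/(2S+1))⁴`, `S ≥ 1`, at any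
  `β ≥ 0`, for time-zero spatial species `A, B` with `|A| ≤ a₀`, `|B| ≤ b₀` and any `μ ≥ 0`:
  the two antipodal bounds `c_{AA}(S) ≤ C_A e^{-μS}`, `c_{BB}(S) ≤ C_B e^{-μS}` alone give
  `|c_{AB}(n)| ≤ √(K_A K_B e^{μ}) e^{-μ n}` for ALL `n ≤ S`, `K_A = max C_A (2a₀²)`,
  `K_B = max C_B (2b₀²)` — constants independent of `S`, `β`, `G`;
* `clustersUniformlyAt_of_antipodalDecayAt` / `clustersUniformlyAt_timeZero_iff` — at fixed
  `β ≥ 0`, torus-uniform exponential clustering (`ClustersUniformlyAt`, the IR-1 predicate of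
  `SoloBlindInfraredFrontier`) of every time-zero spatial pair is EQUIVALENT to antipodal decay
  `AntipodalDecayAt` of every time-zero spatial observable (rate: the minimum of the two).

All compact `G`, all `β ≥ 0`; reflection positivity bookkeeping only (parts 1–6).

References: K. Osterwalder, E. Seiler, Ann. Phys. 110 (1978) 440, §2; E. Seiler, LNP 159 (1982)
Ch. 2; A. Jaffe, E. Witten, *Quantum Yang–Mills theory* (2000) §5.
-/

open MeasureTheory Filter Topology
open Literature.MathematicalPhysics.QuantumFieldTheory Literature.MathematicalPhysics.QuantumLattice

noncomputable section

namespace Summit.QuantumFields.YangMills.Theorems.SoloBlind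

variable {G : Type} [Group G] [TopologicalSpace G] [IsTopologicalGroup G] [CompactSpace G]
  [MeasurableSpace G] [BorelSpace G]

/-- **The single-torus inequality.**  On `(ℤ/(2S+1))⁴`, `S ≥ 1`, `β ≥ 0`, time-zero spatial
`A, B` with `|A| ≤ a₀`, `|B| ≤ b₀`, `μ ≥ 0`: the antipodal diagonal bounds
`c_{AA}(S) ≤ C_A e^{-μS}`, `c_{BB}(S) ≤ C_B e^{-μS}` give
`|c_{AB}(n)| ≤ √(max C_A (2a₀²) · max C_B (2b₀²) · e^{μ}) · e^{-μn}` for all `n ≤ S`.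
[this unit's; endpoint reduction (part 4) + OS Schwarz transfer (part 5)] -/
theorem abs_latticeConnectedCorr_le_of_endpoints {N : ℕ} (ρ : G →* Matrix (Fin N) (Fin N) ℂ)
    (hρ : Continuous ρ) {β : ℝ} (hβ : 0 ≤ β) {S : ℕ} (hS : 1 ≤ S) {A B : YMSpecies G}
    (hA : IsTimeZeroSpatial A) (hB : IsTimeZeroSpatial B) {a₀ b₀ CA CB μ : ℝ}
    (ha : ∀ U, |A.F U| ≤ a₀) (hb : ∀ U, |B.F U| ≤ b₀) (hμ : 0 ≤ μ)
    (hCA : latticeConnectedCorr ρ β (2 * S + 1) A.F A.F S ≤ CA * Real.exp (-(μ * S)))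
    (hCB : latticeConnectedCorr ρ β (2 * S + 1) B.F B.F S ≤ CB * Real.exp (-(μ * S)))
    {n : ℕ} (hn : n ≤ S) :
    |latticeConnectedCorr ρ β (2 * S + 1) A.F B.F n| ≤
      Real.sqrt (max CA (2 * (a₀ * a₀)) * max CB (2 * (b₀ * b₀)) * Real.exp μ) *
        Real.exp (-(μ * n)) := by
  set KA : ℝ := max CA (2 * (a₀ * a₀)) with hKA
  set KB : ℝ := max CB (2 * (b₀ * b₀)) with hKB
  have hKA0 : 0 ≤ KA := le_max_of_le_right
    ((abs_nonneg _).trans (abs_latticeConnectedCorr_le ρ hρ β S A A ha ha 0))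
  have hKB0 : 0 ≤ KB := le_max_of_le_right
    ((abs_nonneg _).trans (abs_latticeConnectedCorr_le ρ hρ β S B B hb hb 0))
  -- the ratio `θ = e^{-μ} ∈ (0, 1]`, `θ⁻¹ = e^{μ}`
  set θ : ℝ := Real.exp (-μ) with hθdef
  have hθ : 0 < θ := Real.exp_pos _
  have hθ1 : θ ≤ 1 := by rw [hθdef]; exact Real.exp_le_one_iff.mpr (by linarith)
  have hθinv : θ⁻¹ = Real.exp μ := by rw [hθdef, ← Real.exp_neg, neg_neg]
  have hθpow : ∀ j : ℕ, Real.exp (-(μ * j)) = θ ^ j := fun j => by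
    rw [hθdef, ← Real.exp_nat_mul]; ring_nf
  -- the centred torus observables and their hypotheses
  obtain ⟨hFm, hFb, hF0⟩ := centred_toTorusObservable_hyps ρ β S A hA
  obtain ⟨hGm, hGb, hG0⟩ := centred_toTorusObservable_hyps ρ β S B hB
  -- full diagonal bounds from the endpoints (part 4)
  have hdiag : ∀ (E : YMSpecies G) (_ : IsTimeZeroSpatial E) {e₀ CE : ℝ}
      (_ : ∀ U, |E.F U| ≤ e₀)
      (_ : latticeConnectedCorr ρ β (2 * S + 1) E.F E.F S ≤ CE * Real.exp (-(μ * S))),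
      ∀ j, j ≤ S → latticeConnectedCorr ρ β (2 * S + 1) E.F E.F j ≤
        max CE (2 * (e₀ * e₀)) * θ ^ j := by
    intro E hE e₀ CE he₀ hEk j hj
    have h0 : latticeConnectedCorr ρ β (2 * S + 1) E.F E.F 0 ≤ max CE (2 * (e₀ * e₀)) :=
      (le_abs_self _).trans ((abs_latticeConnectedCorr_le ρ hρ _ S E E he₀ he₀ 0).trans
        (le_max_right _ _))
    have hS' : latticeConnectedCorr ρ β (2 * S + 1) E.F E.F S ≤
        max CE (2 * (e₀ * e₀)) * Real.exp (-(μ * S)) :=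
      hEk.trans (mul_le_mul_of_nonneg_right (le_max_left _ _) (Real.exp_pos _).le)
    have h := latticeConnectedCorr_self_le_exp_of_endpoints ρ hρ hβ hS E hE h0 hS' hj
    rw [hθpow] at h
    exact h
  have hKF : ∀ j, j ≤ (2 * S + 1) / 2 → timeTwoPtSeq ρ β
      (fun U => toTorusObservable (2 * S + 1) A.F U -
        wilsonExpectation ρ β (toTorusObservable (2 * S + 1) A.F)) j ≤ KA * θ ^ j := by
    intro j hj
    rw [← latticeConnectedCorr_eq_timeTwoPtSeq ρ hρ]
    exact hdiag A hA ha hCA j (by omega)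
  have hKG : ∀ j, j ≤ (2 * S + 1) / 2 → timeTwoPtSeq ρ β
      (fun U => toTorusObservable (2 * S + 1) B.F U -
        wilsonExpectation ρ β (toTorusObservable (2 * S + 1) B.F)) j ≤ KB * θ ^ j := by
    intro j hj
    rw [← latticeConnectedCorr_eq_timeTwoPtSeq ρ hρ]
    exact hdiag B hB hb hCB j (by omega)
  -- the Schwarz transfer (part 5)
  have hmix := timeTwoPtMixedSeq_sq_le_of_geometric ρ ⟨S, rfl⟩ (by omega) hρ hβ
    hFm hFb hF0 hGm hGb hG0 hθ hθ1 hKF hKG (n := n) (by omega)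
  rw [← latticeConnectedCorr_eq_timeTwoPtMixedSeq ρ hρ] at hmix
  -- conclude
  rw [hθpow]
  have hKK : 0 ≤ KA * KB * Real.exp μ := mul_nonneg (mul_nonneg hKA0 hKB0) (Real.exp_pos _).le
  apply abs_le_of_sq_le_sq _ (mul_nonneg (Real.sqrt_nonneg _) (pow_nonneg hθ.le _))
  have hsq : (Real.sqrt (KA * KB * Real.exp μ) * θ ^ n) ^ 2 = KA * KB * Real.exp μ * θ ^ (2 * n) := by
    rw [mul_pow, Real.sq_sqrt hKK, ← pow_mul, mul_comm n 2]
  rw [hsq]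
  calc latticeConnectedCorr ρ β (2 * S + 1) A.F B.F n ^ 2
      = θ * latticeConnectedCorr ρ β (2 * S + 1) A.F B.F n ^ 2 * θ⁻¹ := by
        field_simp
    _ ≤ KA * KB * θ ^ (2 * n) * θ⁻¹ :=
        mul_le_mul_of_nonneg_right hmix (inv_nonneg.mpr hθ.le)
    _ = KA * KB * Real.exp μ * θ ^ (2 * n) := by rw [hθinv]; ring

/-! ### Fixed coupling: IR-1 on the time-zero algebra -/

/-- **Antipodal decay at bare coupling `β`** of the time-zero species `A`: for some `C`, some
lattice rate `m > 0` and threshold `S₀`, `c_{A,A}(S; S) ≤ C e^{-mS}` on every odd torus of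
period `2S+1 ≥ 2S₀+1` — the diagonal, single-separation shadow of `ClustersUniformlyAt`.
[cite: OsterwalderSeiler1978, §2] [cite: JaffeWitten2000, §5] -/
def AntipodalDecayAt (r : LatticeRep G) (β : ℝ) (A : YMSpecies G) : Prop :=
  ∃ C m : ℝ, 0 < m ∧ ∃ S₀ : ℕ, ∀ S : ℕ, S₀ ≤ S →
    latticeConnectedCorr r.ρ β (2 * S + 1) A.F A.F S ≤ C * Real.exp (-(m * S))

/-- Diagonal torus-uniform clustering trivially contains antipodal decay (`n = S`). -/
theorem ClustersUniformlyAt.antipodalDecayAt {r : LatticeRep G} {β : ℝ} {A : YMSpecies G}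
    (h : ClustersUniformlyAt r β A A) : AntipodalDecayAt r β A := by
  obtain ⟨C, m, hm, S₀, hC⟩ := h
  exact ⟨C, m, hm, S₀, fun S hS => (le_abs_self _).trans (hC S hS S le_rfl)⟩

/-- Weakening the rate of an antipodal bound (nonnegative constant). -/
private theorem antipodal_mono {c C m m' : ℝ} {S : ℕ} (hC : 0 ≤ C) (hm : m' ≤ m)
    (h : c ≤ C * Real.exp (-(m * S))) : c ≤ C * Real.exp (-(m' * S)) :=
  h.trans (mul_le_mul_of_nonneg_left (Real.exp_le_exp.mpr (by
    have : (0 : ℝ) ≤ S := Nat.cast_nonneg S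
    nlinarith)) hC)

/-- **IR-1 on the time-zero algebra from antipodal decay** (fixed `β ≥ 0`, every compact `G`):
antipodal decay of `A` and of `B` implies torus-uniform exponential clustering of the pair
`(A, B)`, at the smaller of the two rates. [this unit's] -/
theorem clustersUniformlyAt_of_antipodalDecayAt (r : LatticeRep G) {β : ℝ} (hβ : 0 ≤ β)
    {A B : YMSpecies G} (hA : IsTimeZeroSpatial A) (hB : IsTimeZeroSpatial B)
    (hdA : AntipodalDecayAt r β A) (hdB : AntipodalDecayAt r β B) :
    ClustersUniformlyAt r β A B := by
  obtain ⟨CA, mA, hmA, SA, hCA⟩ := hdA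
  obtain ⟨CB, mB, hmB, SB, hCB⟩ := hdB
  obtain ⟨a₀, ha⟩ := A.bounded
  obtain ⟨b₀, hb⟩ := B.bounded
  set μ : ℝ := min mA mB with hμdef
  have hμ : 0 < μ := lt_min hmA hmB
  -- nonnegative constants first (so that the rates may be weakened to `μ`)
  set KA : ℝ := max CA (2 * (a₀ * a₀)) with hKA
  set KB : ℝ := max CB (2 * (b₀ * b₀)) with hKB
  have hKA0 : 0 ≤ KA := le_max_of_le_right
    ((abs_nonneg _).trans (abs_latticeConnectedCorr_le r.ρ r.continuous β 0 A A ha ha 0))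
  have hKB0 : 0 ≤ KB := le_max_of_le_right
    ((abs_nonneg _).trans (abs_latticeConnectedCorr_le r.ρ r.continuous β 0 B B hb hb 0))
  refine ⟨Real.sqrt (max KA (2 * (a₀ * a₀)) * max KB (2 * (b₀ * b₀)) * Real.exp μ), μ, hμ,
    max (max SA SB) 1, fun S hS n hn => ?_⟩
  have hSA : SA ≤ S := le_trans (le_max_left _ _) ((le_max_left _ _).trans hS)
  have hSB : SB ≤ S := le_trans (le_max_right _ _) ((le_max_left _ _).trans hS)
  have hS1 : 1 ≤ S := (le_max_right _ _).trans hS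
  have hA' : latticeConnectedCorr r.ρ β (2 * S + 1) A.F A.F S ≤ KA * Real.exp (-(μ * S)) :=
    antipodal_mono hKA0 (min_le_left _ _) ((hCA S hSA).trans
      (mul_le_mul_of_nonneg_right (le_max_left _ _) (Real.exp_pos _).le))
  have hB' : latticeConnectedCorr r.ρ β (2 * S + 1) B.F B.F S ≤ KB * Real.exp (-(μ * S)) :=
    antipodal_mono hKB0 (min_le_right _ _) ((hCB S hSB).trans
      (mul_le_mul_of_nonneg_right (le_max_left _ _) (Real.exp_pos _).le))
  exact abs_latticeConnectedCorr_le_of_endpoints r.ρ r.continuous hβ hS1 hA hB ha hb hμ.le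
    hA' hB' hn

/-- **On the time-zero spatial algebra, torus-uniform clustering at `β ≥ 0` (IR-1 there) is
equivalent to antipodal decay of every time-zero spatial observable.** [this unit's] -/
theorem clustersUniformlyAt_timeZero_iff (r : LatticeRep G) {β : ℝ} (hβ : 0 ≤ β) :
    (∀ A B : YMSpecies G, IsTimeZeroSpatial A → IsTimeZeroSpatial B →
        ClustersUniformlyAt r β A B) ↔
      ∀ A : YMSpecies G, IsTimeZeroSpatial A → AntipodalDecayAt r β A :=
  ⟨fun h A hA => (h A A hA hA).antipodalDecayAt,
    fun h _ _ hA hB => clustersUniformlyAt_of_antipodalDecayAt r hβ hA hB (h _ hA) (h _ hB)⟩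

end Summit.QuantumFields.YangMills.Theorems.SoloBlind

end
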